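import Summits.ResolutionOfSingularities.ResolutionOfSingularities.Theorems.FrobeniusLadderFRationalResolutionWeaklyFRegularSurfaceLocal
import Summits.ResolutionOfSingularities.ResolutionOfSingularities.Theorems.FrobeniusLadderFRationalResolutionGorensteinSector
import Literature.AlgebraicGeometry.Resolution.CanonicalResolutionProofs
import HarnessLib

/-!
# Rung 3½ in dimension 2 at a Gorenstein germ: the identity is already a local weakly F-regular model

Support file for crux stmt-ResolutionOfSingularities-15317 (`FrobeniusLadder.FRationalResolution`),
line `Sketch`, continuation seat c3, wave 11, theme (D2R): the crux in dimension `2` reduced to germs.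
Stub `identity_local_model_of_socle_cyclic`.

Let `X/k` be an integral F-rational surface (finite type over a field `k` of characteristic `p`,
`dim X ≤ 2`, every stalk a domain whose parameter ideals are tightly closed — the crux's inline
clause) and `s ∈ X` a singular point whose parameter ideals have CYCLIC SOCLE (`(t) : 𝔪 = (t) + (u)`,
the Gorenstein condition). The singular set `(Reg X)ᶜ` is finite and consists of closed points
(`finite_compl_regularLocus_of_fRational_surface`,
`isClosed_singleton_of_not_mem_regularLocus_of_fRational_surface`), so
`V := X ∖ ((Reg X)ᶜ ∖ {s})` is an open neighbourhood of `s` meeting no other singular point. On `V`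
EVERY stalk is a domain in which every ideal is tightly closed: at `s` by Hochster–Huneke's
"F-rational Gorenstein ⇒ weakly F-regular" in the tree's inline form
(`weaklyFRegular_of_fRational_of_socle_cyclic`, rung 3½ on the Gorenstein sector), at the other
points of `V` by regularity (`weaklyFRegularClause_stalk_of_mem_regularLocus`), transported to the
stalks of the open subscheme `↑V` along the stalk isomorphisms of `V.ι`
(`domain_allIdeals_clause_of_iso`). Hence the IDENTITY `𝟙 ↑V` is a local weakly-F-regular model at
`s` in the sense consumed by the punctual gluing engine `weaklyFRegularModification_surface_of_local`:
proper, an isomorphism over `V ∩ Reg X`, with dense preimage (`Reg X` is dense in the integral `X` —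
it contains the generic point — and `V.ι` is an open map).

References: M. Hochster, C. Huneke, *F-regularity, test elements, and smooth base change*, Trans.
AMS 346 (1994), Thm. 4.2 / Cor. 4.7; J. Lipman, *Desingularization of two-dimensional schemes*,
Ann. of Math. 107 (1978), §2 (one point at a time).
-/

-- single-problem summit: the doubled namespace component is forced
set_option linter.dupNamespace false

noncomputable section

namespace Summit.ResolutionOfSingularities.ResolutionOfSingularities.Theorems.FRationalResolution

open CategoryTheory AlgebraicGeometry TopologicalSpace
open Literature.AlgebraicGeometry.Resolution

/-- **AT A GORENSTEIN F-RATIONAL SURFACE SINGULARITY THE IDENTITY IS A LOCAL WEAKLY F-REGULAR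
MODEL.** For an integral `k`-scheme `X` of finite type over a field `k` of characteristic `p`, of
dimension `≤ 2`, whose stalks satisfy the F-rational clause of `FRationalResolution`, and a singular
point `s ∉ Reg X` whose parameter ideals have cyclic socle (`hsoc`): there is an open `V ∋ s`
containing no other singular point such that `𝟙 ↑V : ↑V ⟶ ↑V` is proper, every stalk of `↑V` is a
domain in which every ideal is tightly closed (inline clause), `𝟙 ↑V` restricts to an isomorphism
over `V ∩ Reg X`, and `V ∩ Reg X` is dense in `↑V`. (`V` := complement of the finitely many other
singular closed points; at `s` use `weaklyFRegular_of_fRational_of_socle_cyclic`, elsewhere on `V`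
regularity.) [Hochster–Huneke 1994, Thm. 4.2] -/
theorem identity_local_model_of_socle_cyclic (p : ℕ) (hp : p.Prime) (k : Type) [Field k]
    [CharP k p] (X : Scheme.{0}) [IsIntegral X] (f : X ⟶ Spec (.of k)) [LocallyOfFiniteType f]
    [QuasiCompact f]
    (hFR : ∀ x : X, IsDomain (X.presheaf.stalk x) ∧ ∀ d : ℕ, ringKrullDim (X.presheaf.stalk x) = d →
      ∀ s : Fin d → X.presheaf.stalk x, (Ideal.span (Set.range s)).radical.IsMaximal →
      ∀ y c : X.presheaf.stalk x, c ≠ 0 →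
      (∀ e : ℕ, c * y ^ p ^ e ∈ Ideal.span ((fun z : X.presheaf.stalk x => z ^ p ^ e) ''
        (Ideal.span (Set.range s) : Set (X.presheaf.stalk x)))) → y ∈ Ideal.span (Set.range s))
    (hdim : topologicalKrullDim X ≤ 2) (s : X) (hs : s ∉ Scheme.regularLocus X)
    (hsoc : ∀ d : ℕ, ringKrullDim (X.presheaf.stalk s) = d → ∀ t : Fin d → X.presheaf.stalk s,
      (Ideal.span (Set.range t)).radical.IsMaximal →
      ∃ u : X.presheaf.stalk s, (Ideal.span (Set.range t)).colon
        (IsLocalRing.maximalIdeal (X.presheaf.stalk s) : Set (X.presheaf.stalk s)) =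
        Ideal.span (Set.range t) ⊔ Ideal.span {u}) :
    ∃ (V : X.Opens), s ∈ V ∧ (∀ t : X, t ∉ Scheme.regularLocus X → t ∈ V → t = s) ∧
      ∃ (Y : Scheme.{0}) (ρ : Y ⟶ V), IsProper ρ ∧
        (∀ y : Y, IsDomain (Y.presheaf.stalk y) ∧ ∀ I : Ideal (Y.presheaf.stalk y),
          ∀ a c : Y.presheaf.stalk y, c ≠ 0 →
          (∀ e : ℕ, c * a ^ p ^ e ∈ Ideal.span ((fun z : Y.presheaf.stalk y => z ^ p ^ e) ''
            (I : Set (Y.presheaf.stalk y)))) → a ∈ I) ∧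
        IsIso (ρ ∣_ (V.ι ⁻¹ᵁ ⟨Scheme.regularLocus X, isOpen_regularLocus_of_locallyOfFiniteType_field f⟩)) ∧
        Dense ((ρ ⁻¹ᵁ (V.ι ⁻¹ᵁ ⟨Scheme.regularLocus X,
          isOpen_regularLocus_of_locallyOfFiniteType_field f⟩) : Y.Opens) : Set Y) := by
  classical
  have _ := hs
  haveI : IsNoetherian X := Scheme.isNoetherian_of_finiteType_over_field f
  -- the open regular locus `U`
  set U : X.Opens := ⟨Scheme.regularLocus X, isOpen_regularLocus_of_locallyOfFiniteType_field f⟩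
    with hU
  -- the other singular points form a finite closed set; `V` is its complement
  have hfin : (Scheme.regularLocus X)ᶜ.Finite :=
    finite_compl_regularLocus_of_fRational_surface p hp k X f hFR hdim
  have hTc : IsClosed ((Scheme.regularLocus X)ᶜ \ {s}) := by
    rw [← Set.biUnion_of_singleton ((Scheme.regularLocus X)ᶜ \ {s})]
    exact (hfin.subset fun _ h => h.1).isClosed_biUnion fun t ht =>
      isClosed_singleton_of_not_mem_regularLocus_of_fRational_surface p hp k X f hFR hdim ht.1
  set V : X.Opens := ⟨((Scheme.regularLocus X)ᶜ \ {s})ᶜ, hTc.isOpen_compl⟩ with hV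
  have hmemV : ∀ t : X, t ∈ V ↔ t ∉ (Scheme.regularLocus X)ᶜ \ {s} := fun t => Iff.rfl
  have hsV : s ∈ V := (hmemV s).mpr fun h => h.2 rfl
  have hVs : ∀ t : X, t ∉ Scheme.regularLocus X → t ∈ V → t = s := fun t ht htV => by
    by_contra hne
    exact (hmemV t).mp htV ⟨ht, hne⟩
  -- at `s`: F-rational with cyclic-socle parameter ideals ⇒ every ideal tightly closed
  have hswf : IsDomain (X.presheaf.stalk s) ∧ ∀ I : Ideal (X.presheaf.stalk s),
      ∀ a c : X.presheaf.stalk s, c ≠ 0 →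
      (∀ e : ℕ, c * a ^ p ^ e ∈ Ideal.span ((fun z : X.presheaf.stalk s => z ^ p ^ e) ''
        (I : Set (X.presheaf.stalk s)))) → a ∈ I :=
    ⟨(hFR s).1, fun I a c hc ha =>
      weaklyFRegular_of_fRational_of_socle_cyclic p (X.presheaf.stalk s) (hFR s).2 hsoc I a c hc ha⟩
  -- at every point of `V`: the stalk of `X` is a domain with every ideal tightly closed
  have hVwf : ∀ x : X, x ∈ V → IsDomain (X.presheaf.stalk x) ∧ ∀ I : Ideal (X.presheaf.stalk x),
      ∀ a c : X.presheaf.stalk x, c ≠ 0 →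
      (∀ e : ℕ, c * a ^ p ^ e ∈ Ideal.span ((fun z : X.presheaf.stalk x => z ^ p ^ e) ''
        (I : Set (X.presheaf.stalk x)))) → a ∈ I := by
    intro x hxV
    by_cases hx : x ∈ Scheme.regularLocus X
    · exact ⟨(hFR x).1, fun I a c hc ha =>
        weaklyFRegularClause_stalk_of_mem_regularLocus p hp k X f hx I a c hc ha⟩
    · rw [hVs x hx hxV]
      exact hswf
  -- `U` is dense in `X`: it contains the generic point (F-rational stalks are normal, and a normal
  -- local ring of dimension `0` is regular)
  have hN : ∀ x : X, IsIntegrallyClosed (X.presheaf.stalk x) :=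
    isIntegrallyClosed_stalk_of_fRational_clause p hp k X f hFR
  have hgen : genericPoint X ∈ U := by
    refine mem_regularLocus_of_ringKrullDim_stalk_le_one hN ?_
    have h0 : ringKrullDim (X.presheaf.stalk (genericPoint X)) = 0 :=
      ringKrullDim_eq_zero_of_field X.functionField
    rw [h0]; exact zero_le_one
  have hUd : Dense (U : Set X) := U.2.dense ⟨genericPoint X, hgen⟩
  have hWd : Dense ((V.ι ⁻¹ᵁ U : (V : Scheme.{0}).Opens) : Set (V : Scheme.{0})) :=
    hUd.preimage V.ι.isOpenEmbedding.isOpenMap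
  refine ⟨V, hsV, hVs, V, 𝟙 _, inferInstance, fun y => ?_, inferInstance, ?_⟩
  · -- the stalks of `↑V` are those of `X` at the points of `V`
    exact domain_allIdeals_clause_of_iso p (asIso (V.ι.stalkMap y)).symm (hVwf y.1 y.2)
  · rw [Scheme.Hom.id_preimage]
    exact hWd

end Summit.ResolutionOfSingularities.ResolutionOfSingularities.Theorems.FRationalResolution

end
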